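import Literature.AlgebraicGeometry.Motives.HodgeLieWeightOneRankTwoRigidity
import HarnessLib

/-!
# Weight one: in a simple `Lie Hg ⊗ ℂ` no non-zero element commutes with all raising and all lowering operators
# (the common tail of the return legs of the rank-twelve crux; Deligne I §3, Moonen–Zarhin 1999 (2.3))

Family `hodge`, layer `Literature/AlgebraicGeometry/Motives`; THEOREMS ONLY (no definition, no named fact; D-0026).  Written for the
cell `pub-hodgeav-hg6` (LADDER-HodgeAV row 2, TABLE X row 1 `g6.I(1)`: brick N13 of the row-1 programme; honest framing: HC / HC_AV /
HC_CM NOT proved — unconditional Hodge–Lie linear algebra).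

WHY.  After N11/N12 (`rankTwelve_sp_or_simple_three_four`, `rankTwelve_sp_or_leviCore`) the rank-twelve crux is a PROPER Levi
involution algebra of type `3|3` or `2|4` on `V^{1,0} ≅ ℂ⁶` inside a SIMPLE `𝔥_ℂ`.  The involution-algebra cores of the tree
(`UnitaryThetaCore.eq_top_two_three'`, `UnitaryTwoOdd.eq_top`, the `(2,4)` core of the cell's unitary programme) return, besides `⊤`,
a tensor SKELETON `V^{1,0} ≅ A ⊗ M` with Levi `⊆ 𝔤𝔩(A) ⊗ 1 + 1 ⊗ 𝔤𝔩(M)`; in the dead complex configurations (`𝔰𝔭₄ ⊕ 𝔰𝔬₃`,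
`𝔰𝔩₂ ⊕ 𝔰𝔬₆`) the factor `𝔰𝔩(A) ⊗ 1` is the ideal `𝔠` of N2, and it COMMUTES WITH EVERY RAISING AND LOWERING OPERATOR.  This file
proves that such an element cannot exist when `𝔥_ℂ` is simple, so the open return leg of the crux is exactly:
«skeleton ⟹ some non-zero `Z ∈ 𝔥_ℂ` commutes with all raising and all lowering operators».

* **`raisingCentralizer_adStable`** — for `𝔊 ⊆ 𝔥_ℂ` bracket-closed containing `Θ`, the subspace
  `𝔷 = {Z ∈ 𝔊 : [Z, x] = 0 for every raising and every lowering x ∈ 𝔊}` is `ad 𝔊`-stable (Jacobi twice: `[X, Z] = [X⁰, Z]` and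
  `[[X⁰, Z], x] = [[X⁰, x], Z] = 0`, `[X⁰, x]` being raising).
* **`false_of_commute_raising_lowering_of_simple`** — if `𝔥_ℂ` is simple (every non-zero `ad`-stable subspace is `𝔥_ℂ`) and
  contains a non-zero raising `B`, then no non-zero `Z ∈ 𝔥_ℂ` commutes with all raising and lowering operators: otherwise `𝔷 = 𝔥_ℂ ∋ B`,
  so `B` commutes with `B̄`, and `B = 0` by `WeightOneThetaIdeal.raising_eq_zero_of_commute_conjOp` (Hodge–Riemann).

## References

* [Deligne1982HodgeCycles] P. Deligne, *Hodge cycles on abelian varieties*, LNM 900 (1982), I §3 (Prop. 3.4, 3.6).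
* [MoonenZarhin1999LowDim] B. Moonen, Yu. Zarhin, *Hodge classes on abelian varieties of low dimension*, Math. Ann. 315 (1999),
  §2 (2.3)–(2.5).
-/

noncomputable section

open scoped TensorProduct

namespace Literature.AlgebraicGeometry.Motives

namespace HodgeStructure

universe u

variable {V : Type u} [AddCommGroup V] [Module ℚ V] [Module.Finite ℚ V] [HodgeTensorFacts.{u, u}] {n : ℤ}

omit [Module.Finite ℚ V] [HodgeTensorFacts.{u, u}] in
set_option maxHeartbeats 1600000 in
/-- **The joint centralizer of the raising and lowering operators is `ad`-stable.**  `𝔊 ⊆ End(V_ℂ)` bracket-closed containing the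
Hodge operator `Θ` (weight one): for `Z ∈ 𝔊` commuting with every raising and every lowering element of `𝔊` and any `X ∈ 𝔊`, the
bracket `[X, Z]` again commutes with every raising and every lowering element of `𝔊`.
[cite: Deligne1982HodgeCycles, I §3 (proof of Prop. 3.4)] [cite: MoonenZarhin1999LowDim, §2 (2.3)] -/
theorem raisingCentralizer_adStable (H : HodgeStructure V n) (hn : n = 1) (heff : H.IsEffective)
    {Θ : Module.End ℂ (ℂ ⊗[ℚ] V)} (hΘ : ∀ p, ∀ x ∈ H.piece p (n - p), Θ x = ((2 * p - n : ℤ) : ℂ) • x)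
    {𝔊 : Submodule ℂ (Module.End ℂ (ℂ ⊗[ℚ] V))} (hbr : ∀ Y ∈ 𝔊, ∀ Z ∈ 𝔊, Y * Z - Z * Y ∈ 𝔊) (hΘ𝔊 : Θ ∈ 𝔊)
    {Z : Module.End ℂ (ℂ ⊗[ℚ] V)}
    (hZr : ∀ x ∈ 𝔊, (∀ p ∈ H.piece 1 0, x p = 0) → (∀ v, x v ∈ H.piece 1 0) → Z * x = x * Z)
    (hZl : ∀ x ∈ 𝔊, (∀ q ∈ H.piece 0 1, x q = 0) → (∀ v, x v ∈ H.piece 0 1) → Z * x = x * Z)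
    {X : Module.End ℂ (ℂ ⊗[ℚ] V)} (hX : X ∈ 𝔊) :
    (∀ x ∈ 𝔊, (∀ p ∈ H.piece 1 0, x p = 0) → (∀ v, x v ∈ H.piece 1 0) →
        (X * Z - Z * X) * x = x * (X * Z - Z * X)) ∧
      (∀ x ∈ 𝔊, (∀ q ∈ H.piece 0 1, x q = 0) → (∀ v, x v ∈ H.piece 0 1) →
        (X * Z - Z * X) * x = x * (X * Z - Z * X)) := by
  subst hn
  obtain ⟨hPmem, hQmem, hΘ10, hΘ01, hΘΘ⟩ := UnitaryTheta.theta_facts H rfl heff hΘ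
  obtain ⟨Xm, hXm, X0, hX0, Xp, hXp, hXsum, hXpP, hXpim, hXmQ, hXmim, -, -, hX0P, hX0Q⟩ :=
    SymplecticTheta.exists_decomp 𝔊 hbr hΘ𝔊 hΘΘ hΘ10 hΘ01 hPmem hQmem hX
  -- `[X, Z] = [X⁰, Z]`
  have hXZ : X * Z - Z * X = X0 * Z - Z * X0 := by
    have h1 : Xp * Z = Z * Xp := (hZr Xp hXp hXpP hXpim).symm
    have h2 : Xm * Z = Z * Xm := (hZl Xm hXm hXmQ hXmim).symm
    rw [hXsum, add_mul, add_mul, mul_add, mul_add, h1, h2]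
    abel
  -- `[X⁰, x]` is raising (resp. lowering) for raising (resp. lowering) `x`
  have hkeyR : ∀ x ∈ 𝔊, (∀ p ∈ H.piece 1 0, x p = 0) → (∀ v, x v ∈ H.piece 1 0) →
      (X0 * Z - Z * X0) * x = x * (X0 * Z - Z * X0) := by
    intro x hx hxP hxim
    have hzx : Z * x = x * Z := hZr x hx hxP hxim
    have hy : X0 * x - x * X0 ∈ 𝔊 := hbr X0 hX0 x hx
    have hyP : ∀ p ∈ H.piece 1 0, (X0 * x - x * X0) p = 0 := fun p hp => by
      rw [LinearMap.sub_apply, Module.End.mul_apply, Module.End.mul_apply, hxP p hp, map_zero, hxP _ (hX0P p hp), sub_zero]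
    have hyim : ∀ v, (X0 * x - x * X0) v ∈ H.piece 1 0 := fun v => by
      rw [LinearMap.sub_apply, Module.End.mul_apply, Module.End.mul_apply]
      exact Submodule.sub_mem _ (hX0P _ (hxim v)) (hxim _)
    have hzy : Z * (X0 * x - x * X0) = (X0 * x - x * X0) * Z := hZr _ hy hyP hyim
    -- Jacobi: `[[X⁰, Z], x] = [X⁰, [Z, x]] + [[X⁰, x], Z] = 0`
    have e : (X0 * Z - Z * X0) * x - x * (X0 * Z - Z * X0) =
        (X0 * (Z * x - x * Z) - (Z * x - x * Z) * X0) - (Z * (X0 * x - x * X0) - (X0 * x - x * X0) * Z) := by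
      simp only [mul_sub, sub_mul, mul_assoc]
      abel
    rw [← sub_eq_zero, e, hzx, sub_self, mul_zero, zero_mul, sub_zero, hzy, sub_self, sub_zero]
  have hkeyL : ∀ x ∈ 𝔊, (∀ q ∈ H.piece 0 1, x q = 0) → (∀ v, x v ∈ H.piece 0 1) →
      (X0 * Z - Z * X0) * x = x * (X0 * Z - Z * X0) := by
    intro x hx hxQ hxim
    have hzx : Z * x = x * Z := hZl x hx hxQ hxim
    have hy : X0 * x - x * X0 ∈ 𝔊 := hbr X0 hX0 x hx
    have hyQ : ∀ q ∈ H.piece 0 1, (X0 * x - x * X0) q = 0 := fun q hq => by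
      rw [LinearMap.sub_apply, Module.End.mul_apply, Module.End.mul_apply, hxQ q hq, map_zero, hxQ _ (hX0Q q hq), sub_zero]
    have hyim : ∀ v, (X0 * x - x * X0) v ∈ H.piece 0 1 := fun v => by
      rw [LinearMap.sub_apply, Module.End.mul_apply, Module.End.mul_apply]
      exact Submodule.sub_mem _ (hX0Q _ (hxim v)) (hxim _)
    have hzy : Z * (X0 * x - x * X0) = (X0 * x - x * X0) * Z := hZl _ hy hyQ hyim
    have e : (X0 * Z - Z * X0) * x - x * (X0 * Z - Z * X0) =
        (X0 * (Z * x - x * Z) - (Z * x - x * Z) * X0) - (Z * (X0 * x - x * X0) - (X0 * x - x * X0) * Z) := by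
      simp only [mul_sub, sub_mul, mul_assoc]
      abel
    rw [← sub_eq_zero, e, hzx, sub_self, mul_zero, zero_mul, sub_zero, hzy, sub_self, sub_zero]
  rw [hXZ]
  exact ⟨hkeyR, hkeyL⟩

set_option maxHeartbeats 1600000 in
/-- **In a simple `𝔥_ℂ`, nothing non-zero commutes with all raising and all lowering operators.**  `H` effective polarized of
weight `1`; every non-zero `ad 𝔥_ℂ`-stable subspace of `𝔥_ℂ` is `𝔥_ℂ`; `B ∈ 𝔥_ℂ` raising, `B ≠ 0`.  Then there is no `Z ∈ 𝔥_ℂ`, `Z ≠ 0`,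
commuting with every raising and every lowering element of `𝔥_ℂ` (else the joint centralizer is all of `𝔥_ℂ`, `B` commutes with
`B̄`, and `B = 0` by the second Hodge–Riemann relation). [cite: Deligne1982HodgeCycles, I §3 Prop. 3.4, Prop. 3.6]
[cite: MoonenZarhin1999LowDim, §2 (2.3)] -/
theorem false_of_commute_raising_lowering_of_simple (H : HodgeStructure V n) (ψ : H.Polarization) (hn : n = 1)
    (heff : H.IsEffective)
    (hsimple : ∀ T : Submodule ℂ (Module.End ℂ (ℂ ⊗[ℚ] V)), T ≤ H.hodgeLieC → T ≠ ⊥ →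
      (∀ Y ∈ H.hodgeLieC, ∀ t ∈ T, Y * t - t * Y ∈ T) → T = H.hodgeLieC)
    {B : Module.End ℂ (ℂ ⊗[ℚ] V)} (hB : B ∈ H.hodgeLieC) (hB0 : B ≠ 0) (hBP : ∀ p ∈ H.piece 1 0, B p = 0)
    (hBim : ∀ v, B v ∈ H.piece 1 0)
    {Z : Module.End ℂ (ℂ ⊗[ℚ] V)} (hZ : Z ∈ H.hodgeLieC) (hZ0 : Z ≠ 0)
    (hZr : ∀ x ∈ H.hodgeLieC, (∀ p ∈ H.piece 1 0, x p = 0) → (∀ v, x v ∈ H.piece 1 0) → Z * x = x * Z)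
    (hZl : ∀ x ∈ H.hodgeLieC, (∀ q ∈ H.piece 0 1, x q = 0) → (∀ v, x v ∈ H.piece 0 1) → Z * x = x * Z) : False := by
  classical
  obtain ⟨hbr, -, -, Θ, hΘ, hΘ𝔤⟩ := hodgeLie_standing H ψ
  have hspan : H.hodgeLieC = spanC H.hodgeLie := hodgeLieC_eq_spanC H
  have hΘC : Θ ∈ H.hodgeLieC := by rw [hspan]; exact hΘ𝔤
  have hbrC : ∀ Y ∈ H.hodgeLieC, ∀ Y' ∈ H.hodgeLieC, Y * Y' - Y' * Y ∈ H.hodgeLieC := fun Y hY Y' hY' => by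
    rw [hspan] at hY hY' ⊢
    exact commutator_mem_spanC hbr hY hY'
  -- the joint centralizer as an `ad`-stable subspace
  obtain ⟨𝔷, h𝔷⟩ : ∃ 𝔷 : Submodule ℂ (Module.End ℂ (ℂ ⊗[ℚ] V)), ∀ Z', Z' ∈ 𝔷 ↔ Z' ∈ H.hodgeLieC ∧
      (∀ x ∈ H.hodgeLieC, (∀ p ∈ H.piece 1 0, x p = 0) → (∀ v, x v ∈ H.piece 1 0) → Z' * x = x * Z') ∧
      (∀ x ∈ H.hodgeLieC, (∀ q ∈ H.piece 0 1, x q = 0) → (∀ v, x v ∈ H.piece 0 1) → Z' * x = x * Z') := by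
    refine ⟨{ carrier := {Z' | Z' ∈ H.hodgeLieC ∧
                (∀ x ∈ H.hodgeLieC, (∀ p ∈ H.piece 1 0, x p = 0) → (∀ v, x v ∈ H.piece 1 0) → Z' * x = x * Z') ∧
                (∀ x ∈ H.hodgeLieC, (∀ q ∈ H.piece 0 1, x q = 0) → (∀ v, x v ∈ H.piece 0 1) → Z' * x = x * Z')}
              zero_mem' := ⟨Submodule.zero_mem _, fun x _ _ _ => by rw [zero_mul, mul_zero],
                fun x _ _ _ => by rw [zero_mul, mul_zero]⟩
              add_mem' := fun {a b} ha hb => ⟨Submodule.add_mem _ ha.1 hb.1,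
                fun x hx h1 h2 => by rw [add_mul, mul_add, ha.2.1 x hx h1 h2, hb.2.1 x hx h1 h2],
                fun x hx h1 h2 => by rw [add_mul, mul_add, ha.2.2 x hx h1 h2, hb.2.2 x hx h1 h2]⟩
              smul_mem' := fun c a ha => ⟨Submodule.smul_mem _ _ ha.1,
                fun x hx h1 h2 => by rw [smul_mul_assoc, mul_smul_comm, ha.2.1 x hx h1 h2],
                fun x hx h1 h2 => by rw [smul_mul_assoc, mul_smul_comm, ha.2.2 x hx h1 h2]⟩ }, fun Z' => Iff.rfl⟩
  have h𝔷le : 𝔷 ≤ H.hodgeLieC := fun Z' hZ' => ((h𝔷 Z').1 hZ').1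
  have h𝔷ne : 𝔷 ≠ ⊥ := fun h => hZ0 (by
    have hm : Z ∈ 𝔷 := (h𝔷 Z).2 ⟨hZ, hZr, hZl⟩
    rw [h, Submodule.mem_bot] at hm
    exact hm)
  have h𝔷ad : ∀ Y ∈ H.hodgeLieC, ∀ Z' ∈ 𝔷, Y * Z' - Z' * Y ∈ 𝔷 := by
    intro Y hY Z' hZ'
    obtain ⟨hZ'𝔥, hZ'r, hZ'l⟩ := (h𝔷 Z').1 hZ'
    obtain ⟨hR, hL⟩ := raisingCentralizer_adStable H hn heff hΘ hbrC hΘC hZ'r hZ'l hY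
    exact (h𝔷 _).2 ⟨hbrC Y hY Z' hZ'𝔥, hR, hL⟩
  have h𝔷top : 𝔷 = H.hodgeLieC := hsimple 𝔷 h𝔷le h𝔷ne h𝔷ad
  -- `B ∈ 𝔷` commutes with `B̄`: contradiction with Hodge–Riemann
  have hB𝔷 : B ∈ 𝔷 := by rw [h𝔷top]; exact hB
  obtain ⟨-, -, hBl⟩ := (h𝔷 B).1 hB𝔷
  obtain ⟨C, hC⟩ := exists_conjOp B
  have hC𝔥 : C ∈ H.hodgeLieC := by
    rw [hspan] at hB ⊢
    exact conjOp_mem_spanC hB hC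
  subst hn
  obtain ⟨hCQ, hCim, -, -⟩ := SymplecticThetaTen.conjOp_raise (P := H.piece 1 0) (Q := H.piece 0 1)
    (fun x hx => conj_mem_piece H hx) (fun x hx => conj_mem_piece H hx) hBP hBim hC
  have hcomm : B * C = C * B := hBl C hC𝔥 hCQ hCim
  exact hB0 (WeightOneThetaIdeal.raising_eq_zero_of_commute_conjOp H ψ rfl heff hΘ hB hBP hBim hC hcomm)

end HodgeStructure

end Literature.AlgebraicGeometry.Motives
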